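import Literature.MathematicalPhysics.QuantumLattice.SchwartzTensorDensityProofs
import Literature.MathematicalPhysics.QuantumLattice.SchwartzLocalDensity
import Literature.MathematicalPhysics.QuantumLattice.SchwartzOrderedWedgeDensity
import Literature.MathematicalPhysics.AQFT.OffDiagonalFlatDecay
import HarnessLib

/-!
# `NPointIsotropy` — compactly supported test functions off the diagonals are limits of
off-diagonal real product tensors

Support file for crux `stmt-QuantumFields-11686` (`PencilRigidity.NPointIsotropy`), line
`complex-rotation-bandlimit`, wave 2 (off-diagonal tensor density), helper stub
`localOffDiagDensity` (step B, the local/compact part).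

**Statement.** Let `G ∈ 𝓢((ℝ⁴)ⁿ, ℂ)` have compact support contained in the complement of the
coincidence locus `A = {x | ∃ i ≠ j, xᵢ = xⱼ}` (`coincidenceLocus`). Then `G` lies in the closure,
for the Schwartz topology, of the `ℂ`-span of the off-diagonal real product tensors
`{P | ∃ f, IsTensorOf P (ofRealTest ∘ f) ∧ IsOffDiagonal P}`.

**Route.** (1) *Uniform separation*: `K = tsupport G` is compact and every `v ∈ K` has pairwise
distinct components, so there is a mesh `h > 0` with `12 h < ‖vᵢ - vⱼ‖` for all `v ∈ K`, `i ≠ j`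
(`IsCompact.eventually_forall_of_forall_eventually`). (2) *Lattice partition of unity at mesh `h`*
in the mesh coordinates `meshCoord` of `SchwartzOrderedWedgeDensity`: `W_R · G → G`
(`tendsto_latticeWindow_smul`) and `W_R · G = ∑_{β ∈ cube R} η_β · G`, so it suffices that every
piece `η_β · G` is in the closed span (the closure of a submodule is a submodule). (3) *One piece*:
`η_β · G` is supported in the closed box `∏ [(β_{ic} - 1) h, (β_{ic} + 1) h]`; if it is nonzero the
box contains a point `v ∈ K`; the box engine `mem_closure_span_boxTensors`
(`SchwartzTensorDensityProofs`, `Λ = id`) with outer box `∏ ((β_{ic} - 2) h, (β_{ic} + 2) h)` puts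
the piece in the closed span of the real product tensors whose factors are supported in the outer
blocks; such a tensor `P` is off-diagonal (`IsOffDiagonal.of_tsupport_subset`): a point
`x ∈ tsupport P` has `xᵢ` in the `i`-th outer block (`IsTensorOf.tsupport_subset`), so `xᵢ = xⱼ`
with `i ≠ j` would force `|vᵢ^c - vⱼ^c| < 6 h` for every coordinate `c`, i.e. `‖vᵢ - vⱼ‖ ≤ 12 h`,
contradicting (1). [folklore]
-/

noncomputable section

open scoped SchwartzMap Topology
open Filter Set
open Literature.MathematicalPhysics.QuantumLattice Literature.MathematicalPhysics.AQFT

namespace Summit.QuantumFields.YangMills.Theorems.NPointIsotropy.ComplexRotationBandlimit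

namespace LocalOffDiagDensity

/-- **Uniform separation of the components on a compact set off the diagonals.** If `K ⊆ (ℝ⁴)ⁿ`
is compact and disjoint from the coincidence locus then there is `h > 0` with `12 h < ‖vᵢ - vⱼ‖`
for all `v ∈ K` and `i ≠ j` (each `{(h, v) | 12 h < ‖vᵢ - vⱼ‖}` is an open neighbourhood of
`(0, y)` for `y ∈ K`; compactness makes the neighbourhood of `0` uniform). [folklore] -/
theorem exists_mesh {n : ℕ} {K : Set (Fin n → EuclideanSpace ℝ (Fin 4))} (hK : IsCompact K)
    (hKA : K ⊆ (coincidenceLocus n (EuclideanSpace ℝ (Fin 4)))ᶜ) :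
    ∃ h : ℝ, 0 < h ∧ ∀ v ∈ K, ∀ i j : Fin n, i ≠ j → 12 * h < ‖v i - v j‖ := by
  have hP : ∀ y ∈ K, ∀ᶠ z : ℝ × (Fin n → EuclideanSpace ℝ (Fin 4)) in 𝓝 (0, y),
      ∀ i j : Fin n, i ≠ j → 12 * z.1 < ‖z.2 i - z.2 j‖ := by
    intro y hy
    refine Filter.eventually_all.2 fun i => Filter.eventually_all.2 fun j => ?_
    by_cases hij : i = j
    · exact Eventually.of_forall fun z hne => absurd hij hne
    · have hyij : y i ≠ y j := fun hyeq => hKA hy ⟨i, j, hij, hyeq⟩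
      have hopen : IsOpen {z : ℝ × (Fin n → EuclideanSpace ℝ (Fin 4)) |
          12 * z.1 < ‖z.2 i - z.2 j‖} :=
        isOpen_lt (continuous_const.mul continuous_fst)
          (((continuous_apply i).comp continuous_snd).sub
            ((continuous_apply j).comp continuous_snd)).norm
      have hmem : ((0 : ℝ), y) ∈ {z : ℝ × (Fin n → EuclideanSpace ℝ (Fin 4)) |
          12 * z.1 < ‖z.2 i - z.2 j‖} := by
        simp only [mem_setOf_eq, mul_zero]
        exact norm_pos_iff.2 (sub_ne_zero.2 hyij)
      exact (hopen.eventually_mem hmem).mono fun z hz _ => hz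
  have hev := hK.eventually_forall_of_forall_eventually
    (P := fun (h : ℝ) (v : Fin n → EuclideanSpace ℝ (Fin 4)) =>
      ∀ i j : Fin n, i ≠ j → 12 * h < ‖v i - v j‖) hP
  obtain ⟨h, hh, hsep⟩ := ((eventually_mem_nhdsWithin (a := (0 : ℝ)) (s := Ioi 0)).and
    (hev.filter_mono nhdsWithin_le_nhds)).exists
  exact ⟨h, mem_Ioi.1 hh, hsep⟩

/-- **One piece of the lattice partition lies in the closed span.** For `G ∈ 𝓢((ℝ⁴)ⁿ, ℂ)` whose
support has components separated by more than `12 h` (`12 h < ‖vᵢ - vⱼ‖` on `tsupport G`,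
`i ≠ j`) and `β ∈ ℤ^{4n}`, the piece `η_β · G` (`η_β` the lattice bump of `SchwartzPartition` in the
mesh coordinates at scale `h`) belongs to the closure of the span of the off-diagonal real product
tensors: it is supported in the closed box `∏ [(β_{ic} - 1) h, (β_{ic} + 1) h]`, which contains a
point `v ∈ tsupport G` unless the piece vanishes; the box engine `mem_closure_span_boxTensors`
with outer box `∏ ((β_{ic} - 2) h, (β_{ic} + 2) h)` applies, and a real product tensor with
factors supported in the outer blocks is supported off the coincidence locus (two equal components
would give `|vᵢ^c - vⱼ^c| < 6 h` for all `c`, so `‖vᵢ - vⱼ‖ ≤ 12 h`). [folklore] -/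
theorem smulLeftCLM_latticeBump_mem_closure {n : ℕ}
    (G : 𝓢((Fin n → EuclideanSpace ℝ (Fin 4)), ℂ)) {h : ℝ} (hh : 0 < h)
    (hsep : ∀ v ∈ tsupport (G : (Fin n → EuclideanSpace ℝ (Fin 4)) → ℂ), ∀ i j : Fin n, i ≠ j →
      12 * h < ‖v i - v j‖) (β : Fin (n * 4) → ℤ) :
    SchwartzMap.smulLeftCLM ℂ (fun y => ((latticeBump (meshCoord n 4 h hh) β y : ℝ) : ℂ)) G ∈
      closure (Submodule.span ℂ {P : 𝓢((Fin n → EuclideanSpace ℝ (Fin 4)), ℂ) |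
        ∃ f : Fin n → 𝓢(EuclideanSpace ℝ (Fin 4), ℝ),
          IsTensorOf P (fun i => ofRealTest (f i)) ∧ IsOffDiagonal P} :
        Set 𝓢((Fin n → EuclideanSpace ℝ (Fin 4)), ℂ)) := by
  -- adapted from `IsTimeOrdered.smulLeftCLM_latticeBump_translate_mem_closure`
  set Gβ := SchwartzMap.smulLeftCLM ℂ (fun y => ((latticeBump (meshCoord n 4 h hh) β y : ℝ) : ℂ)) G
    with hGβ
  -- the box of `β` in the coordinates `v_i^c`
  obtain ⟨b, hb⟩ : ∃ b : Fin n × Fin 4 → ℝ, ∀ ic, b ic = ((β (finProdFinEquiv ic) : ℤ) : ℝ) :=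
    ⟨_, fun _ => rfl⟩
  have hbox : ∀ v ∈ tsupport (Gβ : (Fin n → EuclideanSpace ℝ (Fin 4)) → ℂ), ∀ ic : Fin n × Fin 4,
      b ic * h - h ≤ v ic.1 ic.2 ∧ v ic.1 ic.2 ≤ b ic * h + h := by
    intro v hv ic
    have h1 := (SchwartzMap.tsupport_smulLeftCLM_subset (F := ℂ) _ G hv).2
    rw [tsupport_latticeBumpC (meshCoord n 4 h hh) β] at h1
    have h2 := tsupport_latticeBump_subset (meshCoord n 4 h hh) β h1 (finProdFinEquiv ic)
    rw [meshCoord_apply, mem_Icc, ← hb ic] at h2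
    constructor
    · have h3 : b ic - 1 ≤ v ic.1 ic.2 / h := by linarith [h2.1]
      rw [le_div_iff₀ hh] at h3
      linarith
    · have h3 : v ic.1 ic.2 / h ≤ b ic + 1 := by linarith [h2.2]
      rw [div_le_iff₀ hh] at h3
      linarith
  -- the zero piece
  by_cases hG0 : Gβ = 0
  · rw [hG0]
    exact subset_closure (Submodule.zero_mem _)
  -- otherwise a point of `tsupport G` lies in the box
  obtain ⟨v, hv⟩ : ∃ v, Gβ v ≠ 0 := by
    by_contra hcon
    push Not at hcon
    exact hG0 (SchwartzMap.ext hcon)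
  have hvbox := hbox v (subset_tsupport _ hv)
  have hGv : G v ≠ 0 := by
    rw [hGβ, SchwartzMap.smulLeftCLM_apply_apply
      (hasTemperateGrowth_latticeBumpC (meshCoord n 4 h hh) β)] at hv
    exact right_ne_zero_of_smul hv
  have hvsep := hsep v (subset_tsupport _ hGv)
  -- the nested boxes and the box engine
  let B : BoxData n 4 :=
    { l := fun ic => b ic * h - 2 * h, u := fun ic => b ic * h + 2 * h
      l' := fun ic => b ic * h - h, u' := fun ic => b ic * h + h
      hl := fun ic => by linarith, hl' := fun ic => by linarith, hu := fun ic => by linarith }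
  let Λ₀ : EuclideanSpace ℝ (Fin 4) ≃L[ℝ] EuclideanSpace ℝ (Fin 4) := ContinuousLinearEquiv.refl ℝ _
  have hF' : tsupport (Gβ : (Fin n → EuclideanSpace ℝ (Fin 4)) → ℂ) ⊆
      {v | ∀ ic : Fin n × Fin 4, (Λ₀ (v ic.1)) ic.2 ∈ Icc (B.l' ic) (B.u' ic)} :=
    fun v hv ic => hbox v hv ic
  refine closure_mono (Submodule.span_mono ?_) (mem_closure_span_boxTensors Λ₀ B Gβ hF')
  rintro P ⟨g, hg, hP⟩
  refine ⟨g, hP, IsOffDiagonal.of_tsupport_subset fun x hx => ?_⟩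
  rw [mem_compl_iff, mem_coincidenceLocus]
  rintro ⟨i, j, hij, hxij⟩
  -- the components `x_k` lie in the outer blocks
  have hxk : ∀ (k : Fin n) (c : Fin 4),
      b (k, c) * h - 2 * h < x k c ∧ x k c < b (k, c) * h + 2 * h := by
    intro k c
    have hk : x k ∈ tsupport (g k : EuclideanSpace ℝ (Fin 4) → ℝ) :=
      tsupport_comp_subset (g := fun t : ℝ => (t : ℂ)) Complex.ofReal_zero _
        (hP.tsupport_subset hx k)
    exact hg k hk c
  -- so `x_i = x_j` forces `|v_i^c - v_j^c| ≤ 6 h` for all `c`, i.e. `‖v_i - v_j‖ ≤ 12 h`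
  have hcoord : ∀ c : Fin 4, |(v i - v j) c| ≤ 6 * h := by
    intro c
    rw [PiLp.sub_apply, abs_le]
    have h1 := hxk i c
    have h2 := hxk j c
    have h3 := hvbox (i, c)
    have h4 := hvbox (j, c)
    have h5 : x i c = x j c := by rw [hxij]
    dsimp only at h3 h4
    constructor <;> linarith [h1.1, h1.2, h2.1, h2.2, h3.1, h3.2, h4.1, h4.2]
  have hnorm := EuclideanSpace.norm_le_sqrt_card_mul (v i - v j) (by positivity) hcoord
  have h4 : Real.sqrt (Fintype.card (Fin 4) : ℕ) = 2 := by
    rw [Fintype.card_fin, Nat.cast_ofNat, show (4 : ℝ) = 2 ^ 2 by norm_num,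
      Real.sqrt_sq (by norm_num)]
  rw [h4] at hnorm
  linarith [hvsep i j hij]

end LocalOffDiagDensity

/-- **Compactly supported test functions off the diagonals are limits of off-diagonal real product
tensors** (helper stub `localOffDiagDensity` of the line `complex-rotation-bandlimit`, crux
`NPointIsotropy`). If `G ∈ 𝓢((ℝ⁴)ⁿ, ℂ)` has compact support contained in the complement of the
coincidence locus, then `G` belongs to the closure of the `ℂ`-span of the real product tensors
`P = ⊗ᵢ fᵢ` (`IsTensorOf P (ofRealTest ∘ f)`) that are off-diagonal (`IsOffDiagonal P`). Proof: a
mesh `h` below the separation of the components on `tsupport G`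
(`LocalOffDiagDensity.exists_mesh`); the lattice partition of unity at mesh `h`, `W_R · G → G`
(`tendsto_latticeWindow_smul`) with `W_R · G = ∑_β η_β · G`; every piece is in the closed span
(`LocalOffDiagDensity.smulLeftCLM_latticeBump_mem_closure`), and the closure of a submodule is a
submodule. [folklore] -/
theorem localOffDiagDensity : ∀ (n : ℕ) (G : SchwartzMap (Fin n → EuclideanSpace ℝ (Fin 4)) ℂ), HasCompactSupport (G : (Fin n → EuclideanSpace ℝ (Fin 4)) → ℂ) → tsupport (G : (Fin n → EuclideanSpace ℝ (Fin 4)) → ℂ) ⊆ (Literature.MathematicalPhysics.AQFT.coincidenceLocus n (EuclideanSpace ℝ (Fin 4)))ᶜ → G ∈ closure (Submodule.span ℂ {P : SchwartzMap (Fin n → EuclideanSpace ℝ (Fin 4)) ℂ | ∃ f : Fin n → SchwartzMap (EuclideanSpace ℝ (Fin 4)) ℝ, Literature.MathematicalPhysics.QuantumLattice.IsTensorOf P (fun i => Literature.MathematicalPhysics.QuantumLattice.ofRealTest (f i)) ∧ Literature.MathematicalPhysics.AQFT.IsOffDiagonal P} : Set (SchwartzMap (Fin n → EuclideanSpace ℝ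 (Fin 4)) ℂ)) := by
  intro n G hG hGA
  -- adapted from `IsTimeOrdered.mem_closure_span_slabOrderedProducts` (steps 2–3)
  set S : Set 𝓢((Fin n → EuclideanSpace ℝ (Fin 4)), ℂ) :=
    {P | ∃ f : Fin n → 𝓢(EuclideanSpace ℝ (Fin 4), ℝ),
      IsTensorOf P (fun i => ofRealTest (f i)) ∧ IsOffDiagonal P}
  have hC : IsClosed (closure (Submodule.span ℂ S :
      Set 𝓢((Fin n → EuclideanSpace ℝ (Fin 4)), ℂ))) := isClosed_closure
  -- step 1: a mesh below the separation of the components on the compact `tsupport G`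
  obtain ⟨h, hh, hsep⟩ := LocalOffDiagDensity.exists_mesh hG.isCompact hGA
  -- step 2: the lattice partition of unity at mesh `h`, `W_R · G → G`
  set Λ := meshCoord n 4 h hh
  have hlim : Tendsto (fun R : ℕ => ∑ β ∈ latticeCube (n * 4) R,
      SchwartzMap.smulLeftCLM ℂ (fun y => ((latticeBump Λ β y : ℝ) : ℂ)) G) atTop (𝓝 G) := by
    have hsum : ∀ R : ℕ, ∑ β ∈ latticeCube (n * 4) R,
        SchwartzMap.smulLeftCLM ℂ (fun y => ((latticeBump Λ β y : ℝ) : ℂ)) G =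
          SchwartzMap.smulLeftCLM ℂ (fun y => ((latticeWindow Λ R y : ℝ) : ℂ)) G := by
      intro R
      have hW : (fun y => ((latticeWindow Λ R y : ℝ) : ℂ)) =
          fun y => ∑ β ∈ latticeCube (n * 4) R, ((latticeBump Λ β y : ℝ) : ℂ) := by
        funext y
        rw [← sum_latticeCube_latticeBump Λ R y, Complex.ofReal_sum]
      rw [hW, SchwartzMap.smulLeftCLM_sum fun β _ => hasTemperateGrowth_latticeBumpC Λ β,
        FunLike.coe_sum, Finset.sum_apply]
    simp_rw [hsum]
    exact tendsto_latticeWindow_smul Λ ℂ G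
  refine hC.mem_of_tendsto hlim (Eventually.of_forall fun R => ?_)
  -- step 3: every piece lies in the closed span
  exact (Submodule.span ℂ S).topologicalClosure.sum_mem fun β _ =>
    LocalOffDiagDensity.smulLeftCLM_latticeBump_mem_closure G hh hsep β

end Summit.QuantumFields.YangMills.Theorems.NPointIsotropy.ComplexRotationBandlimit

end
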